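import Mathlib

/-!
# THEOREM S (dict D5 `E2-PAIR-TENSION.md` §2b) — analytic core, kernel shadow

search for candidate a priori estimates; no regularity claim

Authored by census-1 g22 (planner-pub-nsfunc-census-1-g22-0) as the kernel shadow
`pub-nsfunc-census-1/exact/e2pair-A/TheoremSCore.STAGING.lean` v2 (sha16 86ec3bc2ceecba59;
E2SHAPE-CHECK-A, METHODS (cc.42-add1)/(cc.44)); placed in the tree verbatim by the prove seat (gen 9)
under the cell namespace, docstrings added where missing. Static trigonometry for the E2 side-track
(dict D5 `E2-PAIR-TENSION.md` §2b); no K0 row, no PDE statement.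

What is kernel-checked here (pure trigonometry; no geometry, no PDE, no regularity statement):

* `sin_two_mul_add_sin_two_mul_sub` / `sin_add_sin_add_sin_of_sum_zero` :
  `a + b + c = 0 → sin a + sin b + sin c = -4 sin(a/2) sin(b/2) sin(c/2)` —
  THEOREM S (vi): a charge-free 3-valent vertex cannot satisfy the sine law `Σ sin Δᵢ = 0`
  with jumps in `(-π, π) \ {0}` (`no_three_valent_vertex`).
* `defect x := x - sin x` (the vertex-law defect `f`), `defect_shift_sub` :
  `f (x+δ) - f x = δ - 2 sin(δ/2) cos(x + δ/2)`;
  `defect_shift_sub_monotoneOn` / `defect_shift_sub_strictMonoOn` : `x ↦ f(x+δ) - f(x)` is monotone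
  (strictly for `0 < δ`) on `[0, π - δ]` — the engine of THEOREM S STEP 2;
  `step2_term_le` (the termwise inequality `f(E+δ) - f(E) ≤ f(D+δ) - f(D)` for `0 ≤ E ≤ D`, `D + δ ≤ π`)
  and `step2_term_eq` (equality with `0 < δ` forces `E = D`).
-/

namespace Summit.NavierStokesRegularity.FunctionalMining.E2.TheoremSCore

open Real Set

/-- `sin 2α + sin 2β - sin(2α + 2β) = 4 sin α sin β sin(α + β)`. -/
theorem sin_two_mul_add_sin_two_mul_sub (α β : ℝ) :
    sin (2 * α) + sin (2 * β) - sin (2 * α + 2 * β) = 4 * sin α * sin β * sin (α + β) := by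
  have e : 2 * α + 2 * β = 2 * (α + β) := by ring
  rw [e]
  simp only [sin_two_mul, sin_add, cos_add]
  linear_combination (-2 * sin α * cos α) * sin_sq_add_cos_sq β +
    (-2 * sin β * cos β) * sin_sq_add_cos_sq α

/-- THEOREM S (vi), the identity: for `a + b + c = 0`,
`sin a + sin b + sin c = -4 sin(a/2) sin(b/2) sin(c/2)`. -/
theorem sin_add_sin_add_sin_of_sum_zero (a b c : ℝ) (h : a + b + c = 0) :
    sin a + sin b + sin c = -4 * sin (a / 2) * sin (b / 2) * sin (c / 2) := by
  have hc : c = -(a + b) := by linarith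
  subst hc
  have k := sin_two_mul_add_sin_two_mul_sub (a / 2) (b / 2)
  have e1 : 2 * (a / 2) = a := by ring
  have e2 : 2 * (b / 2) = b := by ring
  rw [e1, e2] at k
  rw [show -(a + b) / 2 = -(a / 2 + b / 2) by ring, sin_neg, sin_neg]
  linear_combination k

/-- THEOREM S (vi): no charge-free 3-valent vertex. If `a + b + c = 0` with all three jumps in
`(-π, π)` and non-zero, then `sin a + sin b + sin c ≠ 0`. -/
theorem no_three_valent_vertex (a b c : ℝ) (h : a + b + c = 0)
    (ha : a ∈ Ioo (-π) π) (hb : b ∈ Ioo (-π) π) (hc : c ∈ Ioo (-π) π)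
    (ha0 : a ≠ 0) (hb0 : b ≠ 0) (hc0 : c ≠ 0) :
    sin a + sin b + sin c ≠ 0 := by
  rw [sin_add_sin_add_sin_of_sum_zero a b c h]
  have hne : ∀ x : ℝ, x ∈ Ioo (-π) π → x ≠ 0 → sin (x / 2) ≠ 0 := by
    intro x hx hx0
    apply Real.sin_eq_zero_iff_of_lt_of_lt (by linarith [hx.1, pi_pos]) (by linarith [hx.2, pi_pos]) |>.not.mpr
    intro h0; exact hx0 (by linarith)
  have h1 := hne a ha ha0
  have h2 := hne b hb hb0
  have h3 := hne c hc hc0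
  intro H
  have : (4 : ℝ) * sin (a / 2) * sin (b / 2) * sin (c / 2) = 0 := by linarith
  simp only [mul_eq_zero, OfNat.ofNat_ne_zero, false_or] at this
  rcases this with (h | h) | h
  · exact h1 h
  · exact h2 h
  · exact h3 h

/-- The vertex-law defect `f(x) = x - sin x`. -/
noncomputable def defect (x : ℝ) : ℝ := x - sin x

/-- `defect_shift_sub` (THEOREM S analytic core, census-1 kernel shadow; see module doc). [ours; elementary] -/
theorem defect_shift_sub (x δ : ℝ) :
    defect (x + δ) - defect x = δ - 2 * sin (δ / 2) * cos (x + δ / 2) := by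
  unfold defect
  have hs := sin_sub_sin (x + δ) x
  rw [show (x + δ - x) / 2 = δ / 2 by ring, show (x + δ + x) / 2 = x + δ / 2 by ring] at hs
  linear_combination (-1 : ℝ) * hs

/-- THEOREM S STEP 2 engine: `x ↦ f(x + δ) - f(x)` is monotone on `[0, π - δ]` for `0 ≤ δ ≤ π`. -/
theorem defect_shift_sub_monotoneOn {δ : ℝ} (hδ : 0 ≤ δ) (hδπ : δ ≤ π) :
    MonotoneOn (fun x => defect (x + δ) - defect x) (Icc 0 (π - δ)) := by
  intro x hx y hy hxy
  simp only [defect_shift_sub]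
  have hcos : cos (y + δ / 2) ≤ cos (x + δ / 2) :=
    cos_le_cos_of_nonneg_of_le_pi (by linarith [hx.1]) (by linarith [hy.2]) (by linarith)
  have hs : 0 ≤ sin (δ / 2) :=
    sin_nonneg_of_nonneg_of_le_pi (by linarith) (by linarith [pi_pos])
  nlinarith [mul_le_mul_of_nonneg_left hcos hs]

/-- … and strictly monotone for `0 < δ ≤ π`. -/
theorem defect_shift_sub_strictMonoOn {δ : ℝ} (hδ : 0 < δ) (hδπ : δ ≤ π) :
    StrictMonoOn (fun x => defect (x + δ) - defect x) (Icc 0 (π - δ)) := by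
  intro x hx y hy hxy
  simp only [defect_shift_sub]
  have hcos : cos (y + δ / 2) < cos (x + δ / 2) :=
    cos_lt_cos_of_nonneg_of_le_pi (by linarith [hx.1]) (by linarith [hy.2]) (by linarith)
  have hs : 0 < sin (δ / 2) :=
    sin_pos_of_pos_of_lt_pi (by linarith) (by linarith [pi_pos])
  nlinarith [mul_lt_mul_of_pos_left hcos hs]

/-- The termwise inequality of THEOREM S STEP 2. -/
theorem step2_term_le {E D δ : ℝ} (hE : 0 ≤ E) (hED : E ≤ D) (hδ : 0 ≤ δ) (hDδ : D + δ ≤ π) :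
    defect (E + δ) - defect E ≤ defect (D + δ) - defect D := by
  have hδπ : δ ≤ π := by linarith
  exact defect_shift_sub_monotoneOn hδ hδπ ⟨hE, by linarith⟩ ⟨by linarith, by linarith⟩ hED

/-- … and its equality case: with `0 < δ`, equality forces `E = D`. -/
theorem step2_term_eq {E D δ : ℝ} (hE : 0 ≤ E) (hED : E ≤ D) (hδ : 0 < δ) (hDδ : D + δ ≤ π)
    (heq : defect (E + δ) - defect E = defect (D + δ) - defect D) : E = D := by
  have hδπ : δ ≤ π := by linarith
  exact (defect_shift_sub_strictMonoOn hδ hδπ).injOn ⟨hE, by linarith⟩ ⟨by linarith, by linarith⟩ heq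

/-- `f` itself: `f 0 = 0`, `f` is monotone on `ℝ` (so `0 ≤ f x` for `0 ≤ x`). -/
theorem defect_zero : defect 0 = 0 := by simp [defect]

/-- `defect_monotone` (THEOREM S analytic core, census-1 kernel shadow; see module doc). [ours; elementary] -/
theorem defect_monotone : Monotone defect := by
  intro x y hxy
  unfold defect
  have := Real.sin_sub_sin y x
  have hb : |sin ((y - x) / 2)| ≤ |(y - x) / 2| := abs_sin_le_abs  -- |sin t| ≤ |t|
  have hc : |cos ((y + x) / 2)| ≤ 1 := abs_cos_le_one _
  have : sin y - sin x ≤ y - x := by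
    rw [this]
    have h1 : |2 * sin ((y - x) / 2) * cos ((y + x) / 2)| ≤ 2 * |(y - x) / 2| * 1 := by
      rw [abs_mul, abs_mul, abs_two]
      gcongr
    have h2 : 2 * |(y - x) / 2| * 1 = y - x := by
      rw [abs_of_nonneg (by linarith)]; ring
    linarith [le_abs_self (2 * sin ((y - x) / 2) * cos ((y + x) / 2))]
  linarith

/-! ### STEP 2 as a finite chain
Data of THEOREM S STEP 2 after STEP 1: `E 0 = 0`, `E (j+1) = E j + δ (j+1)` with `δ ≥ 0` (so `E` is the running sum of
the thin openings), tops `D (j+1) > 0` with `E j ≤ D (j+1)` and `D (j+1) + δ (j+1) ≤ π`. The two vertex laws (Σ Δ = 0 and the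
sine law Σ sin Δ = 0) combine to `∑_{j<m} [f(D_{j+1} + δ_{j+1}) − f(D_{j+1})] = f(E_m)`; the chain below shows the left side is
`≥ f(E_m)` always and `> f(E_m)` as soon as `E_m > 0` — so the sine law cannot hold (`step2_chain_false`).
(Hypotheses are stated for all `j`; only `j < m` matter — pad with `δ = 0`, `D = E_m` beyond `m` when `E_m ≤ π`.) -/

/-- `defect x ≥ 0` for `x ≥ 0` (THEOREM S analytic core, census-1 kernel shadow). [ours; elementary] -/
theorem defect_nonneg {x : ℝ} (hx : 0 ≤ x) : 0 ≤ defect x := by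
  have := defect_monotone hx; rwa [defect_zero] at this

/-- `step2_chain` (THEOREM S analytic core, census-1 kernel shadow; see module doc). [ours; elementary] -/
theorem step2_chain (D δ E : ℕ → ℝ) (hE0 : E 0 = 0) (hE : ∀ j, E (j + 1) = E j + δ (j + 1))
    (hδ : ∀ j, 0 ≤ δ (j + 1)) (hD : ∀ j, 0 < D (j + 1)) (hED : ∀ j, E j ≤ D (j + 1))
    (hπ : ∀ j, D (j + 1) + δ (j + 1) ≤ π) (m : ℕ) :
    defect (E m) ≤ ∑ j ∈ Finset.range m, (defect (D (j + 1) + δ (j + 1)) - defect (D (j + 1))) ∧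
    (0 < E m → defect (E m) < ∑ j ∈ Finset.range m, (defect (D (j + 1) + δ (j + 1)) - defect (D (j + 1)))) := by
  have hEnn : ∀ j, 0 ≤ E j := by
    intro j
    induction j with
    | zero => simp [hE0]
    | succ n ih => rw [hE]; linarith [hδ n]
  induction m with
  | zero => simp [hE0, defect_zero]
  | succ n ih =>
    obtain ⟨ih1, ih2⟩ := ih
    rw [Finset.sum_range_succ]
    have hterm : defect (E n + δ (n + 1)) - defect (E n) ≤
        defect (D (n + 1) + δ (n + 1)) - defect (D (n + 1)) :=
      step2_term_le (hEnn n) (hED n) (hδ n) (hπ n)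
    refine ⟨?_, ?_⟩
    · rw [hE n]; linarith
    · intro hpos
      by_cases hn : 0 < E n
      · have := ih2 hn
        rw [hE n]; linarith
      · have hEn0 : E n = 0 := le_antisymm (not_lt.mp hn) (hEnn n)
        have hδpos : 0 < δ (n + 1) := by rw [hE n, hEn0] at hpos; linarith
        have hδπ : δ (n + 1) ≤ π := by linarith [hπ n, hD n]
        have hstrict := defect_shift_sub_strictMonoOn hδpos hδπ
          (show (0 : ℝ) ∈ Icc 0 (π - δ (n + 1)) from ⟨le_refl 0, by linarith [hπ n, hD n]⟩)
          (show D (n + 1) ∈ Icc 0 (π - δ (n + 1)) from ⟨(hD n).le, by linarith [hπ n]⟩) (hD n)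
        simp only [zero_add] at hstrict
        rw [hE n, hEn0, zero_add]
        rw [hEn0, defect_zero] at ih1
        rw [defect_zero] at hstrict
        linarith

/-- THEOREM S STEP 2, conclusion: with `E_m > 0` the combined vertex law
`∑_{j<m} [f(D_{j+1} + δ_{j+1}) − f(D_{j+1})] = f(E_m)` is impossible. -/
theorem step2_chain_false (D δ E : ℕ → ℝ) (hE0 : E 0 = 0) (hE : ∀ j, E (j + 1) = E j + δ (j + 1))
    (hδ : ∀ j, 0 ≤ δ (j + 1)) (hD : ∀ j, 0 < D (j + 1)) (hED : ∀ j, E j ≤ D (j + 1))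
    (hπ : ∀ j, D (j + 1) + δ (j + 1) ≤ π) (m : ℕ) (hpos : 0 < E m)
    (hlaw : ∑ j ∈ Finset.range m, (defect (D (j + 1) + δ (j + 1)) - defect (D (j + 1))) = defect (E m)) :
    False := by
  have := (step2_chain D δ E hE0 hE hδ hD hED hπ m).2 hpos
  linarith

end Summit.NavierStokesRegularity.FunctionalMining.E2.TheoremSCore
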